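import Summits.ResolutionOfSingularities.ResolutionOfSingularities.Theorems.FrobeniusClosingSteerNoSatelliteStep
import Summits.ResolutionOfSingularities.ResolutionOfSingularities.Theorems.FrobeniusClosingSteerNoSatelliteStepTwoBasisSupport
import Summits.ResolutionOfSingularities.ResolutionOfSingularities.Theorems.FrobeniusClosingSteerNestedCohenFrames
import Mathlib.Algebra.CharP.Subring
import HarnessLib

/-!
# Crux `Steer` (stmt-ResolutionOfSingularities-16345), chain W4.1, hGW3 piece **(S_λ): LEMMA S, λ-TWISTED — NO SATELLITE STEP** at constant cleaned order
# `2e ≥ 4` for isolated `2`-radicands at a RATIONAL window whose residue field is IMPERFECT with a finite 2-basis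

OURS (campaign `res-hironaka`, rung L ★L-G4, slot W4.1; seat res-L0-w41-stub-3 g8, res-L0-w41-plan-1 RULING 251 (c) «S_λ → stub-3»; spec = res-L0-w41-stub-2's
`hGW3-ASSEMBLY-MAP.md` d0970ee959ebaf4a §2 «(S_λ) satellite exclusion for IMPERFECT κ, rational centres = I″'s separable part; binder shape = (LS) with `hperf₀` REPLACED
by a 2-frame; (W)/(Σ) κ-free; frames by `NestedFrames` twice; only (N) changes» (res-L0-w41-tri-1 v6.18 (a)–(f)); statement scratch `L/res-L0-w41-stub-3/work-g8/Slam/SigSLambda.lean`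
7f96ada59b1ad326; replaces the role of no printed item; NOT a statement of the manuscript under review [claim: Hironaka2017, status: under-review]; AI-produced, weaker
than expert review). Theses-free, definition-free.

ARGUMENT = res-L0-w41-stub-2's (LS) `NoSatelliteStep.span_excParam_eq_of_rational` (p549989) with two substitutions. FRAMES: instead of (T0)+(F)+(Tsq)+(R) (which need a
perfect residue field to make the coefficient fields unique / `S₀` realisable), the coefficient field of `Ŝ₀` is CHOSEN once and NESTED along the two rational steps
(`NestedFrames.exists_frame_with_section`, `NestedFrames.exists_nested_frames_of_section` at the letter `x`, then at the letter `y` — res-L0-w41-stub-2 p550901 +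
chaining form): `E₁ ∘ (S₀ ⊂ S₁) = ρ₀_* ∘ θ_x ∘ E₀` gives (α) for free, `E₂ ∘ (S₁ ⊂ S₂) = ρ₁_* ∘ θ_y ∘ E₁` is the chart square. NON-ISOLATEDNESS: instead of (Σ)+(N)
(`F = ψ² + ι` needs `K` perfect), the package `NoSatelliteStepTwoBasis.not_hasIsolatedSingularity_of_window_twoBasis` ((Σ) on `oddPart F`, (Σ_λ) on the λ-components
`sqPart F ε`, `ε ≠ 0`, then (CD0)) over a finite 2-basis of `κ(Ŝ₁) ≃ κ(S₁)`. (W), (β), (γ), the descent to `S₁` (excellence) and the square-unit renormalisation are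
VERBATIM from (LS).

* `NoSatelliteStepTwoBasis.prod_pow_chartExp` — the monomial relations of the chart at a letter, as products;
* `NoSatelliteStepTwoBasis.span_excParam_eq_of_rational_twoBasis` — **(S_λ)**. [folklore]
-/

noncomputable section

set_option linter.dupNamespace false

open IsLocalRing MvPowerSeries
open Literature.AlgebraicGeometry.Resolution Literature.RingTheory.MvPowerSeries Literature.RingTheory.MvPowerSeries.monoidPowerSeries
open Summit.ResolutionOfSingularities.ResolutionOfSingularities.Theorems.SwitchingDichotomy
open Summit.ResolutionOfSingularities.ResolutionOfSingularities.Theorems.SwitchingDichotomy.SigmaTopLegality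
open Summit.ResolutionOfSingularities.ResolutionOfSingularities.Theorems.SwitchingDichotomy.NoTangentialStep
open Summit.ResolutionOfSingularities.ResolutionOfSingularities.Theorems.SwitchingDichotomy.ChartMonomialSubst
open Summit.ResolutionOfSingularities.ResolutionOfSingularities.Theorems.SwitchingDichotomy.TwoBasis

namespace Summit.ResolutionOfSingularities.ResolutionOfSingularities.Theorems.SwitchingDichotomy.NoSatelliteStepTwoBasis

/-! ## The chart relations as monomials -/

/-- The monomial `∏_{j'} v j' ^ (chart exponent i) j'` of the chart at the letter `j` with weight `M`: `v j` for `i = j`, `v j ^ M · v i` otherwise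
(res-L0-w41-stub-2's `FreeChainBoundPBasis.prod_pow_chartExp`, any number of letters and any persisting letter). [folklore] -/
theorem prod_pow_chartExp {R : Type} [CommMonoid R] {n : ℕ} (v : Fin n → R) (j : Fin n) (M : ℕ) (i : Fin n) :
    ∏ j', v j' ^ ((Finsupp.single i 1 + if i = j then 0 else M • Finsupp.single j 1 : Fin n →₀ ℕ) j') =
      if i = j then v j else v j ^ M * v i := by
  classical
  have hsingle : ∀ (k : Fin n) (N : ℕ), ∏ j', v j' ^ ((Finsupp.single k N : Fin n →₀ ℕ) j') = v k ^ N := by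
    intro k N
    rw [Finset.prod_eq_single k (fun j' _ hj => by rw [Finsupp.single_apply, if_neg (Ne.symm hj), pow_zero])
      (fun h => absurd (Finset.mem_univ k) h), Finsupp.single_eq_same]
  simp_rw [Finsupp.add_apply, pow_add, Finset.prod_mul_distrib, hsingle, pow_one]
  split_ifs with hi
  · simp_rw [Finsupp.coe_zero, Pi.zero_apply, pow_zero, Finset.prod_const_one, mul_one]
    rw [hi]
  · simp_rw [Finsupp.smul_apply, smul_eq_mul, pow_mul', Finset.prod_pow, hsingle, pow_one, mul_comm]

/-! ## (S_λ) — Lemma S, λ-twisted, one window -/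

variable {L : Type} [Field L] [CharP L 2]

/-- **(S_λ) LEMMA S, λ-TWISTED — NO SATELLITE STEP.** One window `S₀ ≤ S₁ ≤ S₂ ≤ S₃` of quadratic transforms of regular local subrings of dimension `c ≥ 2` in
characteristic `2`, radicand laws of constant exponent `2e ≥ 4`, `κ(S₁)` with a FINITE 2-BASIS (imperfect allowed), `S₁` excellent, isolated torsor germ at `S₁`,
RATIONAL centres at `S₁` and `S₂`: then the second step is NOT a satellite step — `(x₀) = (x₁)` in `S₂`. Signature = res-L0-w41-stub-2's (LS)
`NoSatelliteStep.span_excParam_eq_of_rational` with `(hperf₀ : PerfectField (ResidueField S₀))` replaced by `(hB₁ : ∃ r b, TwoBasis.IsTwoBasis (b : Fin r → κ(S₁)))`.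
[cite: Matsumura1987, Thm. 14.2, Thm. 28.3, Thm. 29.7; §32 p. 260] [folklore] -/
theorem span_excParam_eq_of_rational_twoBasis (c e : ℕ) (hc : 2 ≤ c) (he : 2 ≤ e)
    {S₀ S₁ S₂ S₃ : Subring L} [IsLocalRing S₀] [IsLocalRing S₁] [IsLocalRing S₂] [IsLocalRing S₃]
    (h₀₁ : S₀ ≤ S₁) (h₁₂ : S₁ ≤ S₂) (h₂₃ : S₂ ≤ S₃)
    (hreg₀ : IsRegularLocalRing S₀) (hreg₁ : IsRegularLocalRing S₁) (hreg₂ : IsRegularLocalRing S₂)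
    (hdim₀ : ringKrullDim S₀ = c) (hdim₁ : ringKrullDim S₁ = c) (hdim₂ : ringKrullDim S₂ = c)
    (hqt₀ : IsQuadraticTransform S₀ S₁) (hqt₁ : IsQuadraticTransform S₁ S₂) (hqt₂ : IsQuadraticTransform S₂ S₃)
    (f₀ g₀ : S₀) (f₁ g₁ : S₁) (f₂ g₂ : S₂) (f₃ : S₃) (x₀ : S₁) (x₁ : S₂) (x₂ : S₃)
    (hx₀ : Ideal.span ((fun y : S₀ => (⟨(y : L), h₀₁ y.2⟩ : S₁)) '' (maximalIdeal S₀ : Set S₀)) = Ideal.span {x₀})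
    (hx₁ : Ideal.span ((fun y : S₁ => (⟨(y : L), h₁₂ y.2⟩ : S₂)) '' (maximalIdeal S₁ : Set S₁)) = Ideal.span {x₁})
    (hx₂ : Ideal.span ((fun y : S₂ => (⟨(y : L), h₂₃ y.2⟩ : S₃)) '' (maximalIdeal S₂ : Set S₂)) = Ideal.span {x₂})
    (hlaw₀ : ((f₁ : S₁) : L) * ((x₀ : S₁) : L) ^ (2 * e) = ((f₀ : S₀) : L) - ((g₀ : S₀) : L) ^ 2)
    (hlaw₁ : ((f₂ : S₂) : L) * ((x₁ : S₂) : L) ^ (2 * e) = ((f₁ : S₁) : L) - ((g₁ : S₁) : L) ^ 2)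
    (hlaw₂ : ((f₃ : S₃) : L) * ((x₂ : S₃) : L) ^ (2 * e) = ((f₂ : S₂) : L) - ((g₂ : S₂) : L) ^ 2)
    (hB₁ : ∃ (r : ℕ) (b : Fin r → ResidueField S₁), TwoBasis.IsTwoBasis b) (hexc₁ : IsExcellentRing S₁)
    (hiso₁ : HasIsolatedSingularity (RadicandRing S₁ 2 f₁))
    (hrat₀ : ∀ z : S₁, ∃ s : S₀, z - ⟨(s : L), h₀₁ s.2⟩ ∈ maximalIdeal S₁)
    (hrat₁ : ∀ z : S₂, ∃ s : S₁, z - ⟨(s : L), h₁₂ s.2⟩ ∈ maximalIdeal S₂) :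
    Ideal.span {(⟨((x₀ : S₁) : L), h₁₂ x₀.2⟩ : S₂)} = Ideal.span {x₁} := by
  classical
  haveI : Fact (Nat.Prime 2) := ⟨Nat.prime_two⟩
  haveI := hreg₀
  haveI := hreg₁
  haveI := hreg₂
  by_contra hsat
  obtain ⟨m, rfl⟩ : ∃ m, c = m + 2 := ⟨c - 2, by omega⟩
  have hdom₀ : SubringDominates S₀ S₁ := hqt₀.dominates
  have hdom₁ : SubringDominates S₁ S₂ := hqt₁.dominates
  -- ### (W) window coordinates (κ-free, verbatim from (LS))
  obtain ⟨X, Y, Yk, y, z, x', w, u₀, v, hu₀, hv, hx₀u, hx₁v, hgen₀, hgen₁, hgen₂, hY, hYk, hXrel, hzrel⟩ :=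
    NoSatelliteWindow.exists_window h₀₁ h₁₂ hreg₀ hdim₀ hqt₀ hqt₁ x₀ x₁ hx₀ hx₁ hrat₀ hrat₁ hsat
  -- ### the two inclusions are local, with monomial chart relations at the letters `x` (`0`) and `y` (`1`)
  have hφ₀₁ : (maximalIdeal S₀).map (Subring.inclusion h₀₁) ≤ maximalIdeal S₁ :=
    Ideal.map_le_iff_le_comap.mpr fun a ha => FreeChain.inclusion_mem_maximalIdeal hdom₀ ha
  have hφ₁₂ : (maximalIdeal S₁).map (Subring.inclusion h₁₂) ≤ maximalIdeal S₂ :=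
    Ideal.map_le_iff_le_comap.mpr fun a ha => FreeChain.inclusion_mem_maximalIdeal hdom₁ ha
  have hrel₀ : ∀ i, Subring.inclusion h₀₁ ((Fin.cons X (Fin.cons Y Yk) : Fin (m + 2) → S₀) i) =
      ∏ j, (Fin.cons (Subring.inclusion h₀₁ X) (Fin.cons y z) : Fin (m + 2) → S₁) j ^
        ((Finsupp.single i 1 + if i = 0 then 0 else 1 • Finsupp.single 0 1 : Fin (m + 2) →₀ ℕ) j) := by
    intro i
    rw [prod_pow_chartExp]
    refine Fin.cases ?_ (fun k => ?_) i
    · rw [if_pos rfl, Fin.cons_zero, Fin.cons_zero]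
    · rw [if_neg (Fin.succ_ne_zero k), pow_one, Fin.cons_succ, Fin.cons_zero, Fin.cons_succ]
      refine Fin.cases ?_ (fun k' => ?_) k
      · rw [Fin.cons_zero, Fin.cons_zero]; exact hY
      · rw [Fin.cons_succ, Fin.cons_succ]; exact hYk k'
  have hrel₁ : ∀ i, Subring.inclusion h₁₂ ((Fin.cons (Subring.inclusion h₀₁ X) (Fin.cons y z) : Fin (m + 2) → S₁) i) =
      ∏ j, (Fin.cons x' (Fin.cons (Subring.inclusion h₁₂ y) w) : Fin (m + 2) → S₂) j ^
        ((Finsupp.single i 1 + if i = 1 then 0 else 1 • Finsupp.single 1 1 : Fin (m + 2) →₀ ℕ) j) := by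
    intro i
    rw [prod_pow_chartExp]
    refine Fin.cases ?_ (fun k => ?_) i
    · rw [if_neg Fin.zero_ne_one, pow_one, Fin.cons_zero, Fin.cons_one, Fin.cons_zero, Fin.cons_zero, mul_comm]; exact hXrel
    · refine Fin.cases ?_ (fun k' => ?_) k
      · rw [Fin.succ_zero_eq_one, if_pos rfl, Fin.cons_one, Fin.cons_zero, Fin.cons_one, Fin.cons_zero]
      · rw [if_neg (Fin.succ_succ_ne_one k'), pow_one, Fin.cons_succ, Fin.cons_succ, Fin.cons_one, Fin.cons_zero, Fin.cons_succ, Fin.cons_succ,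
          mul_comm]
        exact hzrel k'
  -- ### NESTED FRAMES: a coefficient field of `Ŝ₀` pushed along the two rational steps
  obtain ⟨σ₀, frame₀, hσ₀, hf₀x, hf₀σ, -⟩ := NestedFrames.exists_frame_with_section 2 hdim₀ _ hgen₀
  obtain ⟨frame₁, ρ₀, σ₁, hσ₁, hf₁x, hf₁σ, -, -, hsq₀⟩ := NestedFrames.exists_nested_frames_of_section 2 (Subring.inclusion h₀₁) hφ₀₁ hrat₀
    hdim₁ _ hgen₀ _ hgen₁ _ (chartExp_ne_zero 0 1) hrel₀ σ₀ hσ₀ frame₀ hf₀x hf₀σ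
  obtain ⟨frame₂, ρ₁, σ₂, -, hf₂x, -, -, -, hsq₁⟩ := NestedFrames.exists_nested_frames_of_section 2 (Subring.inclusion h₁₂) hφ₁₂ hrat₁
    hdim₂ _ hgen₁ _ hgen₂ _ (chartExp_ne_zero 1 1) hrel₁ σ₁ hσ₁ frame₁ hf₁x hf₁σ
  -- the finite-level expansions `E₁ = frame₁ ∘ (S₁ → Ŝ₁)`, `E₂ = frame₂ ∘ (S₂ → Ŝ₂)`
  set E₁ : S₁ →+* MvPowerSeries (Fin (m + 2)) (ResidueField (AdicCompletion (maximalIdeal S₁) S₁)) :=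
    frame₁.toRingHom.comp (algebraMap S₁ (AdicCompletion (maximalIdeal S₁) S₁)) with hE₁def
  set E₂ : S₂ →+* MvPowerSeries (Fin (m + 2)) (ResidueField (AdicCompletion (maximalIdeal S₂) S₂)) :=
    frame₂.toRingHom.comp (algebraMap S₂ (AdicCompletion (maximalIdeal S₂) S₂)) with hE₂def
  have hE₁ : ∀ s, E₁ s = frame₁ (algebraMap S₁ _ s) := fun s => rfl
  have hE₂ : ∀ s, E₂ s = frame₂ (algebraMap S₂ _ s) := fun s => rfl
  have hE₁x : ∀ i, E₁ ((Fin.cons (Subring.inclusion h₀₁ X) (Fin.cons y z) : Fin (m + 2) → S₁) i) = MvPowerSeries.X i := fun i => by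
    rw [hE₁]; exact hf₁x i
  have hE₂x : ∀ i, E₂ ((Fin.cons x' (Fin.cons (Subring.inclusion h₁₂ y) w) : Fin (m + 2) → S₂) i) = MvPowerSeries.X i := fun i => by
    rw [hE₂]; exact hf₂x i
  -- characteristic `2` on the completions and their residue fields
  haveI : CharP (AdicCompletion (maximalIdeal S₁) S₁) 2 := RadicandCohenFrame.charP_adicCompletion 2 S₁
  haveI : CharP (ResidueField (AdicCompletion (maximalIdeal S₁) S₁)) 2 := RadicandCohenFrame.charP_residueField 2
  haveI : CharP (AdicCompletion (maximalIdeal S₂) S₂) 2 := RadicandCohenFrame.charP_adicCompletion 2 S₂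
  haveI : CharP (ResidueField (AdicCompletion (maximalIdeal S₂) S₂)) 2 := RadicandCohenFrame.charP_residueField 2
  -- ### (α) realisability of `S₀` through `E₁` = the first square, and (β), (γ)
  have hreal : ∀ s : S₀, ∃ H : MvPowerSeries (Fin (m + 2)) (ResidueField (AdicCompletion (maximalIdeal S₁) S₁)),
      substGenerators (R := ResidueField (AdicCompletion (maximalIdeal S₁) S₁))
        (fun i : Fin (m + 2) => Finsupp.single i 1 + if i = 0 then 0 else 1 • Finsupp.single 0 1) (chartExp_ne_zero 0 1) H =
          E₁ (Subring.inclusion h₀₁ s) := fun s =>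
    ⟨MvPowerSeries.map (ρ₀ : _ →+* _) (frame₀ (algebraMap S₀ _ s)), by rw [← map_substGenerators_chart, hE₁, hsq₀]⟩
  have hA1₁ := CleaningOptimal.sub_pow_mem_pow_of_law 2 hreg₁ hqt₁ h₁₂ f₁ g₁ f₂ x₁ e hx₁ hlaw₁
  have hA1₂ := CleaningOptimal.sub_pow_mem_pow_of_law 2 hreg₂ hqt₂ h₂₃ f₂ g₂ f₃ x₂ e hx₂ hlaw₂
  obtain ⟨⟨H, hα⟩, hβ⟩ := NoSatelliteStep.reading_alpha_beta h₀₁ E₁ _ hgen₁ hE₁x X (Fin.cons_zero _ _) hreal f₀ g₀ f₁ g₁ x₀ u₀ hx₀u hlaw₀ hA1₁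
  obtain ⟨A, R, hR, hγ⟩ := NoSatelliteStep.reading_gamma h₁₂ E₂ _ hgen₂ hE₂x y (by rw [Fin.cons_one, Fin.cons_zero]) f₁ g₁ u₀ f₂ g₂ x₁ v hx₁v
    hlaw₁ hA1₂
  -- the second square: `E₂ (s) = ρ₁_* (θ_y (E₁ s))`
  rw [hE₂, hsq₁, ← hE₁] at hγ
  -- ### (Σ)+(Σ_λ)+(N_λ) over a 2-basis of `κ(Ŝ₁) ≃ κ(S₁)`
  obtain ⟨r, b, hb⟩ := hB₁
  have hbK := IsTwoBasis.map_ringEquiv (RingEquiv.ofBijective _ (AdicCompletion.residueField_map_bijective S₁)) hb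
  have hN := not_hasIsolatedSingularity_of_window_twoBasis he _ hbK ρ₁ hα hβ hR hγ
  rw [hE₁] at hN
  -- ### descent to `S₁` and the square-unit renormalisation (verbatim from (LS))
  have hN' := NoSatelliteStep.not_hasIsolatedSingularity_of_ringEquiv_adicCompletion 2 hexc₁ (u₀ ^ (2 * e) * f₁) frame₁ hN
  exact hN' (RadicandRenorm.isolated_renorm 2 (hu₀.pow e) (w := 0) (by ring) hiso₁)

end Summit.ResolutionOfSingularities.ResolutionOfSingularities.Theorems.SwitchingDichotomy.NoSatelliteStepTwoBasis

end
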